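/-
Copyright: lit-balaban Phase-2 proof seat p02 (gen 4).  Statement-level skeleton of a published paper; no proof claims beyond
what the kernel checks below.
-/
import Literature.MathematicalPhysics.QuantumFieldTheory.Balaban1983to89.B5ChangeOfGauge123
import Literature.MathematicalPhysics.QuantumFieldTheory.Balaban1983to89.Beta.GaussianIntegral

/-!
# `BalabanImbrieJaffe1984to88.BIJ88FictitiousField5131` — T. Bałaban, J. Imbrie, A. Jaffe, *Effective action and cluster
properties of the abelian Higgs model*, Commun. Math. Phys. **114** (1988) 257–315 [BalabanImbrieJaffe1988]: Sect. 5.13,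
**(5.13.1)** — the fictitious integration `dB` trading the constraints `δ((QA^{(k)″})(b′))`, and the next display
*"Integrating out B yields 𝒩⁻¹∫dA^{(k)″} exp[−½⟨A^{(k)″}, Q*QA^{(k)″}⟩] δ_Ax(A^{(k)″}) f((I − Q^{s*}Q)A^{(k)″})"* — PROVED as
theorems about Lebesgue (additive Haar) integrals on the finite-dimensional configuration spaces the print describes

statement-level skeleton of published theorems with citation tags; proofs where landed; nothing here is a claim about the Yang–Mills mass gap

PDF held: `paper:balaban1988-cmp114-bij-abelian-higgs-effective-action` (journal page = PDF page + 256; offloaded store file,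
`lit pull papers/<key>/original.pdf`).  Page read as an image: PDF p. 48 (journal 304), `g4png.py` ×2 render
`run/shared/lean/pub/lit-balaban/lit-balaban-p02/pages/original-p048-x2.png`.

CITATION HEADER (lean-in-tree rule).  Part of the lit-balaban TYPED SKELETON (HOME `run/shared/lean/pub/lit-balaban/`),
Phase-2 seat p02 (gen 4), row **C2.Eq5.13.1-5.13.2** of `HOME/SKELETON.md` (reader file `HOME/lit-balaban-r16/ROWS-C2-part2.md`;
the reader's `BIJ88Sect5StatementsPart4` header records *"NOT typed: … (5.13.1)"*).  Companion `BIJ88Form5132LowerBound` (the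
lower-bound sentence following (5.13.2)).

THE PRINTED TEXT (p. 304 [PDF 48], verbatim).  *"The factors δ((QA^{(k)″})(b′)) in the measure constitute an interaction
between blocks. It is convenient to treat them directly, so we trade them for a fictitious integration dB, where B is a field on
Λ₁₀^{(k)′c*c}. We insert 1 = 𝒩⁻¹∫dB exp(−1/2⟨B, B⟩) and translate A^{(k)″} by Q^{s*}B to obtain
  ∫dA^{(k)″}|_{Λ₁₀^{(k)c*c}} δ_{Λ₁₀^{(k)′c*c}}(QΛ₁₀^{(k)c*c}A) δ_{Ax,Λ₁₀^{(k)*}}(A^{(k)″}) f(A^{(k)″})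
    = 𝒩⁻¹ ∫dA^{(k)″}dB e^{−1/2⟨B,B⟩} δ(QA^{(k)″} + QQ^{s*}B) δ_Ax(A^{(k)″}) f(A^{(k)″} + Q^{s*}B).           (5.13.1)
The translation does not affect δ_Ax, and by (I.2.19) we have QQ^{s*} = I. Integrating out B yields
  𝒩⁻¹ ∫dA^{(k)″} exp[−½⟨A^{(k)″}, Q*QA^{(k)″}⟩] δ_Ax(A^{(k)″}) f((I − Q^{s*}Q)A^{(k)″}).
Thus we have a new quadratic form for Λ₁₀^{(k)c*c}A^{(k)″}, namely Q*Q + (I − Q*Q^s)∂*σ_{k,loc}∂(I − Q^{s*}Q). (5.13.2)"* … and,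
further down the page, *"Applying (5.13.1) to numerator and denominator of the dμ^{(k)}_{Λ₁₀^{(k)}}-integral in (5.12.8), the 𝒩's
cancel"*.

THE MODEL (finite-dimensional, exactly the printed generality; the same engine as the tree's
`…Balaban1983to89.B5ChangeOfGauge123` §2 = [Balaban1984PropagatorsI] (1.23), Haar uniqueness).
* `V` — a finite-dimensional real normed space with an additive Haar (Lebesgue) measure `μV`: the configurations `A^{(k)″}` on
  `Λ₁₀^{(k)c*c}` SATISFYING THE AXIAL GAUGE CONDITIONS, i.e. `∫dA^{(k)″} δ_Ax(A^{(k)″}) (…)` is `∫ … ∂μV`;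
* `γ` — the finite set of block bonds `b′ ⊂ Λ₁₀^{(k)′c*c}`; `B : γ → ℝ` with Lebesgue `volume` = `dB`, `⟨B, B⟩ = B ⬝ᵥ B`;
* `Q : V →ₗ[ℝ] (γ → ℝ)` (the bond average on axial configurations) and `Qss : (γ → ℝ) →ₗ[ℝ] V` (= `Q^{s*}`, which lands in
  the axial configurations — the printed *"The translation does not affect δ_Ax"*), with `Q ∘ Qss = id` (= (I.2.19), the tree's
  `BIJ85Eq219Proof.bondAvg_Qsstar` on the tori);
* `K` with an injective `ι : K →ₗ[ℝ] V` onto `ker Q` and an additive Haar measure `μK`: the constraint surface `{QA^{(k)″} = 0}`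
  inside the axial configurations, so that `∫dA^{(k)″} δ(QA^{(k)″}) δ_Ax(A^{(k)″}) f(A^{(k)″})` is `∫ f(ι a) ∂μK`; the affine
  surfaces `{QA^{(k)″} = −c}` carry the translated measure (`deltaInt`, δ-calculus by parametrisation, translation-covariant
  by `deltaInt_translate`);
* `f : V → ℝ` ARBITRARY (no measurability or integrability: both sides of every identity below are junk together).

WHAT IS KERNEL-CHECKED (zero `sorry`, standard axioms).
* §1 the fictitious-field coordinates `(A₀, B) ↦ A^{(k)″} = ιA₀ + Q^{s*}B` are a linear isomorphism `K × (γ → ℝ) ≃ V`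
  (`splitEquiv`; `Q(ιA₀ + Q^{s*}B) = B`, `(I − Q^{s*}Q)(ιA₀ + Q^{s*}B) = ιA₀`);
* §2 **`integral_split`** — `dA^{(k)″} = jac · dA₀ dB` for every integrand (`jac > 0` the Haar comparison constant of the chosen
  normalisations; Mathlib's uniqueness of Haar measure through `B5ChangeOfGauge123.integral_comp_slice_orbit`);
* §3 **`eq5131`** — (5.13.1) AS PRINTED (insert the Gaussian unit, translate; `𝒩_B = ∫dB e^{−½⟨B,B⟩} = √(2π)^{|γ|}`), and
  **`eq5131_out`** — *"Integrating out B yields …"*: `∫dA″δ(QA″)δ_Ax f = 𝒩⁻¹ ∫dA″ e^{−½⟨QA″,QA″⟩} δ_Ax f((I − Q^{s*}Q)A″)` with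
  `𝒩 = √(2π)^{|γ|}/jac > 0` (`calN`, `calN_pos`); equivalently **`eq5131_integrated`**; and **`ratio_eq`** — *"the 𝒩's cancel"*:
  normalised expectations over `{QA″ = 0}` equal normalised expectations in the weight `e^{−½⟨A″,Q*QA″⟩}` of `f ∘ (I − Q^{s*}Q)`;
  `integrable_iff` — the weighted integrand is integrable `dμV` iff `f∘ι` is integrable `dμK` (the two sides are finite together);
* §4 non-vacuity: the hypotheses hold in the product model `V = K × (γ → ℝ)`, `Q = snd`, `Q^{s*} = inr`, `ι = inl`
  (`productModel_hyps`, `eq5131_out_productModel`).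
READING (recorded, not an objection).  Print keeps the same letter `𝒩 = ∫dB e^{−½⟨B,B⟩}` after integrating out `B`, i.e. it
normalises the δ-measure `dA″δ(QA″)` so that `jac = 1`; with arbitrary Haar normalisations `μV`, `μK` the constant is
`√(2π)^{|γ|}/jac`, and only the ratio statement `ratio_eq` (which is what p. 304 uses) is normalisation-free.
NOT here: (5.13.2) and its lower bound (companion file), the identification of `V`, `K`, `Q`, `Q^{s*}` with the Sect. 5
carriers of `BIJ88Sect5Statements*` (this file is the measure-theoretic identity they instantiate), (5.12.8).
Unit `lit-balaban-p02` (literature-prover-lit-balaban-p02-g4-0), 2026-08-21.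
-/

noncomputable section

open MeasureTheory
open scoped BigOperators

namespace Literature.MathematicalPhysics.QuantumFieldTheory.BalabanImbrieJaffe1984to88.BIJ88FictitiousField5131

open Literature.MathematicalPhysics.QuantumFieldTheory.Balaban1983to89

/-! ## §1  The fictitious-field coordinates `A″ = A₀ + Q^{s*}B` (linear algebra of `QQ^{s*} = I`) -/

section Split

variable {V K : Type*} [AddCommGroup V] [Module ℝ V] [AddCommGroup K] [Module ℝ K] {γ : Type*}
variable (Q : V →ₗ[ℝ] (γ → ℝ)) (Qss : (γ → ℝ) →ₗ[ℝ] V) (ι : K →ₗ[ℝ] V)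

/-- The translation map of (5.13.1): `(A₀, B) ↦ A₀ + Q^{s*}B` (`A₀` on the constraint surface `QA″ = 0`, `B` the fictitious
field). [cite: BalabanImbrieJaffe1988, (5.13.1) p.304] -/
def splitMap : (K × (γ → ℝ)) →ₗ[ℝ] V := ι.coprod Qss

/-- `splitMap (A₀, B) = ιA₀ + Q^{s*}B`. [cite: BalabanImbrieJaffe1988, (5.13.1) p.304] -/
theorem splitMap_apply (p : K × (γ → ℝ)) : splitMap Qss ι p = ι p.1 + Qss p.2 := rfl

variable {Q Qss ι}

/-- `QQ^{s*} = I` pointwise ((I.2.19), hypothesis `hQ`). [cite: BalabanImbrieJaffe1988, (5.13.1) p.304] -/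
theorem Q_Qss (hQ : Q ∘ₗ Qss = LinearMap.id) (B : γ → ℝ) : Q (Qss B) = B := by
  simpa using LinearMap.congr_fun hQ B

/-- `Q` vanishes on the constraint surface `ι(K) = ker Q`. [cite: BalabanImbrieJaffe1988, (5.13.1) p.304] -/
theorem Q_ι (hιQ : LinearMap.range ι = LinearMap.ker Q) (a : K) : Q (ι a) = 0 := by
  have h : ι a ∈ LinearMap.ker Q := hιQ ▸ LinearMap.mem_range_self ι a
  simpa using h

/-- In the fictitious-field coordinates the block average reads off `B`: `Q(A₀ + Q^{s*}B) = B`.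
[cite: BalabanImbrieJaffe1988, (5.13.1) p.304] -/
theorem Q_splitMap (hQ : Q ∘ₗ Qss = LinearMap.id) (hιQ : LinearMap.range ι = LinearMap.ker Q) (p : K × (γ → ℝ)) :
    Q (splitMap Qss ι p) = p.2 := by
  rw [splitMap_apply, map_add, Q_ι hιQ, Q_Qss hQ, zero_add]

/-- … and `(I − Q^{s*}Q)(A₀ + Q^{s*}B) = A₀`. [cite: BalabanImbrieJaffe1988, (5.13.1) p.304] -/
theorem proj_splitMap (hQ : Q ∘ₗ Qss = LinearMap.id) (hιQ : LinearMap.range ι = LinearMap.ker Q) (p : K × (γ → ℝ)) :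
    splitMap Qss ι p - Qss (Q (splitMap Qss ι p)) = ι p.1 := by
  rw [Q_splitMap hQ hιQ, splitMap_apply, add_sub_cancel_right]

/-- The coordinates are one-to-one. [cite: BalabanImbrieJaffe1988, (5.13.1) p.304] -/
theorem splitMap_injective (hQ : Q ∘ₗ Qss = LinearMap.id) (hι : Function.Injective ι)
    (hιQ : LinearMap.range ι = LinearMap.ker Q) : Function.Injective (splitMap Qss ι) := by
  intro p q h
  have h2 : p.2 = q.2 := by
    have := congrArg Q h
    rwa [Q_splitMap hQ hιQ, Q_splitMap hQ hιQ] at this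
  have h1 : p.1 = q.1 := by
    apply hι
    rw [← proj_splitMap hQ hιQ p, ← proj_splitMap hQ hιQ q, h]
  exact Prod.ext h1 h2

/-- The coordinates are onto: every axial `A″` is `A₀ + Q^{s*}(QA″)` with `A₀ = (I − Q^{s*}Q)A″` on the constraint surface.
[cite: BalabanImbrieJaffe1988, (5.13.1) p.304] -/
theorem splitMap_surjective (hQ : Q ∘ₗ Qss = LinearMap.id) (hιQ : LinearMap.range ι = LinearMap.ker Q) :
    Function.Surjective (splitMap Qss ι) := by
  intro A
  have hmem : A - Qss (Q A) ∈ LinearMap.range ι := by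
    rw [hιQ, LinearMap.mem_ker, map_sub, Q_Qss hQ, sub_self]
  obtain ⟨a, ha⟩ := hmem
  exact ⟨(a, Q A), by rw [splitMap_apply, ha, sub_add_cancel]⟩

/-- **The fictitious-field coordinates as a linear isomorphism** `K × (γ → ℝ) ≃ V`, `(A₀, B) ↦ A₀ + Q^{s*}B`.
[cite: BalabanImbrieJaffe1988, (5.13.1) p.304] -/
def splitEquiv (hQ : Q ∘ₗ Qss = LinearMap.id) (hι : Function.Injective ι)
    (hιQ : LinearMap.range ι = LinearMap.ker Q) : (K × (γ → ℝ)) ≃ₗ[ℝ] V :=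
  LinearEquiv.ofBijective (splitMap Qss ι) ⟨splitMap_injective hQ hι hιQ, splitMap_surjective hQ hιQ⟩

/-- `splitEquiv (A₀, B) = ιA₀ + Q^{s*}B`. [cite: BalabanImbrieJaffe1988, (5.13.1) p.304] -/
theorem splitEquiv_apply (hQ : Q ∘ₗ Qss = LinearMap.id) (hι : Function.Injective ι)
    (hιQ : LinearMap.range ι = LinearMap.ker Q) (p : K × (γ → ℝ)) :
    splitEquiv hQ hι hιQ p = ι p.1 + Qss p.2 := rfl

end Split

/-! ## §2  (5.13.1): the Gaussian unit in `B` and the δ-integrals over the surfaces `{QA″ = −c}` -/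

section Delta

variable {V K : Type*} [AddCommGroup V] [Module ℝ V] [AddCommGroup K] [Module ℝ K] [MeasurableSpace K]
  {γ : Type} [Fintype γ]

/-- The Gaussian unit weight of the fictitious field, `e^{−½⟨B,B⟩}`. [cite: BalabanImbrieJaffe1988, (5.13.1) p.304] -/
def gaussB (B : γ → ℝ) : ℝ := Real.exp (-(1/2 : ℝ) * (B ⬝ᵥ B))

/-- `e^{−½⟨B,B⟩} > 0`. [cite: BalabanImbrieJaffe1988, (5.13.1) p.304] -/
theorem gaussB_pos (B : γ → ℝ) : 0 < gaussB B := Real.exp_pos _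

variable (γ) in
/-- `𝒩_B := ∫dB e^{−½⟨B,B⟩}` (the printed "𝒩" of the inserted unit). [cite: BalabanImbrieJaffe1988, (5.13.1) p.304] -/
def calNB : ℝ := ∫ B : γ → ℝ, gaussB B

/-- `𝒩_B = √(2π)^{|γ|}` (the tree's `Beta.GaussianIntegral.integral_exp_neg_half_dotProduct_self`).
[cite: BalabanImbrieJaffe1988, (5.13.1) p.304] -/
theorem calNB_eq : calNB γ = Real.sqrt (2 * Real.pi) ^ Fintype.card γ :=
  Beta.GaussianIntegral.integral_exp_neg_half_dotProduct_self

/-- `𝒩_B > 0`. [cite: BalabanImbrieJaffe1988, (5.13.1) p.304] -/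
theorem calNB_pos : 0 < calNB γ := by
  rw [calNB_eq]
  exact pow_pos (Real.sqrt_pos.2 (by positivity)) _

/-- *"We insert 1 = 𝒩⁻¹∫dB exp(−1/2⟨B, B⟩)"*. [cite: BalabanImbrieJaffe1988, (5.13.1) p.304] -/
theorem insert_one : (calNB γ)⁻¹ * ∫ B : γ → ℝ, gaussB B = 1 :=
  inv_mul_cancel₀ calNB_pos.ne'

/-- **δ-calculus by parametrisation.**  `deltaInt Qss ι μK c g := "∫dA″ δ(QA″ + c) δ_Ax(A″) g(A″)"` — the integral of `g` over the
affine surface `{A″ axial : QA″ = −c}`, parametrised from the constraint surface `K` by `A₀ ↦ ιA₀ − Q^{s*}c` (indeed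
`Q(ιA₀ − Q^{s*}c) = −c`, `deltaInt_on_surface`) and carrying the translate of `μK`. [cite: BalabanImbrieJaffe1988, (5.13.1) p.304] -/
def deltaInt (Qss : (γ → ℝ) →ₗ[ℝ] V) (ι : K →ₗ[ℝ] V) (μK : Measure K) (c : γ → ℝ) (g : V → ℝ) : ℝ :=
  ∫ a, g (ι a - Qss c) ∂μK

variable {Q : V →ₗ[ℝ] (γ → ℝ)} {Qss : (γ → ℝ) →ₗ[ℝ] V} {ι : K →ₗ[ℝ] V}

omit [MeasurableSpace K] [Fintype γ] in
/-- The parametrisation lands on the surface `QA″ = −c`. [cite: BalabanImbrieJaffe1988, (5.13.1) p.304] -/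
theorem deltaInt_on_surface (hQ : Q ∘ₗ Qss = LinearMap.id) (hιQ : LinearMap.range ι = LinearMap.ker Q) (c : γ → ℝ)
    (a : K) : Q (ι a - Qss c) = -c := by
  rw [map_sub, Q_ι hιQ, Q_Qss hQ, zero_sub]

omit [Fintype γ] in
/-- `deltaInt 0 g = ∫dA″ δ(QA″) δ_Ax(A″) g(A″) = ∫ g∘ι dμK` (the left side of (5.13.1)).
[cite: BalabanImbrieJaffe1988, (5.13.1) p.304] -/
theorem deltaInt_zero (μK : Measure K) (g : V → ℝ) : deltaInt Qss ι μK 0 g = ∫ a, g (ι a) ∂μK := by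
  simp [deltaInt]

omit [Fintype γ] in
/-- **Translation covariance of the δ-integrals** — the printed *"translate A^{(k)″} by Q^{s*}B"* (with *"The translation
does not affect δ_Ax"*: `Q^{s*}` lands in the axial configurations): `∫dA″ δ(QA″ + c) g(A″ + Q^{s*}t) = ∫dA″ δ(QA″ + (c − t)) g(A″)`.
[cite: BalabanImbrieJaffe1988, (5.13.1) p.304] -/
theorem deltaInt_translate (μK : Measure K) (c t : γ → ℝ) (g : V → ℝ) :
    deltaInt Qss ι μK c (fun A => g (A + Qss t)) = deltaInt Qss ι μK (c - t) g := by
  simp only [deltaInt, map_sub]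
  congr 1
  funext a
  congr 1
  abel

/-- **(5.13.1) as printed**: `∫dA″δ(QA″)δ_Ax(A″)f(A″) = 𝒩⁻¹∫dA″dB e^{−½⟨B,B⟩} δ(QA″ + QQ^{s*}B) δ_Ax(A″) f(A″ + Q^{s*}B)` — insert
the unit `1 = 𝒩⁻¹∫dB e^{−½⟨B,B⟩}`, then translate `A″ ↦ A″ + Q^{s*}B` in the inner δ-integral (by `QQ^{s*} = I` the translated
constraint `δ(QA″ + QQ^{s*}B)` is `δ(QA″ + B)`, and the translation covariance `deltaInt_translate` returns the left side,
for every `B`).  No measurability or integrability of `f` is needed. [cite: BalabanImbrieJaffe1988, (5.13.1) p.304] -/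
theorem eq5131 (μK : Measure K) (hQ : Q ∘ₗ Qss = LinearMap.id) (f : V → ℝ) :
    deltaInt Qss ι μK 0 f =
      (calNB γ)⁻¹ * ∫ B : γ → ℝ, gaussB B * deltaInt Qss ι μK (Q (Qss B)) (fun A => f (A + Qss B)) := by
  have h : ∀ B : γ → ℝ, deltaInt Qss ι μK (Q (Qss B)) (fun A => f (A + Qss B)) = deltaInt Qss ι μK 0 f := by
    intro B
    rw [deltaInt_translate, Q_Qss hQ, sub_self]
  simp_rw [h]
  rw [integral_mul_const, ← mul_assoc, insert_one, one_mul]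

end Delta

/-! ## §3  `dA″ = jac · dA₀ dB` and "integrating out B" -/

section Generic

variable {M₀ Λ N : Type*}
  [NormedAddCommGroup M₀] [NormedSpace ℝ M₀] [FiniteDimensional ℝ M₀] [MeasurableSpace M₀] [BorelSpace M₀]
  [NormedAddCommGroup Λ] [NormedSpace ℝ Λ] [FiniteDimensional ℝ Λ] [MeasurableSpace Λ] [BorelSpace Λ]
  [NormedAddCommGroup N] [NormedSpace ℝ N] [FiniteDimensional ℝ N] [MeasurableSpace N] [BorelSpace N]

/-- The constant Jacobian of a linear change of variables `e : M₀ × Λ ≃ N` between additive Haar measures: the Haar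
comparison constant of `(μ₀ ⊗ ν)∘e⁻¹` against `μ` (the tree's `B5ChangeOfGauge123` §2, named). [folklore]
[cite: BalabanImbrieJaffe1988, (5.13.1) p.304] -/
def haarJac (μ₀ : Measure M₀) (ν : Measure Λ) (μ : Measure N) [μ₀.IsAddHaarMeasure] [ν.IsAddHaarMeasure]
    [μ.IsAddHaarMeasure] (e : (M₀ × Λ) ≃L[ℝ] N) : NNReal :=
  Measure.addHaarScalarFactor ((μ₀.prod ν).map e) μ

omit [FiniteDimensional ℝ N] in
/-- The Jacobian constant is positive (Haar measures are non-zero on open sets). [folklore]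
[cite: BalabanImbrieJaffe1988, (5.13.1) p.304] -/
theorem haarJac_pos (μ₀ : Measure M₀) (ν : Measure Λ) (μ : Measure N) [μ₀.IsAddHaarMeasure] [ν.IsAddHaarMeasure]
    [μ.IsAddHaarMeasure] (e : (M₀ × Λ) ≃L[ℝ] N) : 0 < haarJac μ₀ ν μ e :=
  B5ChangeOfGauge123.jacobian_pos μ₀ ν μ e

/-- Change of variables along `e` for every integrand: `∫ G∘e d(μ₀ ⊗ ν) = haarJac · ∫ G dμ` (the tree's
`B5ChangeOfGauge123.integral_comp_slice_orbit`). [folklore] [cite: BalabanImbrieJaffe1988, (5.13.1) p.304] -/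
theorem integral_comp_haarJac {E : Type*} [NormedAddCommGroup E] [NormedSpace ℝ E] (μ₀ : Measure M₀) (ν : Measure Λ)
    (μ : Measure N) [μ₀.IsAddHaarMeasure] [ν.IsAddHaarMeasure] [μ.IsAddHaarMeasure] (e : (M₀ × Λ) ≃L[ℝ] N) (G : N → E) :
    ∫ p, G (e p) ∂(μ₀.prod ν) = (haarJac μ₀ ν μ e : ℝ) • ∫ n, G n ∂μ :=
  B5ChangeOfGauge123.integral_comp_slice_orbit μ₀ ν μ e G

end Generic

section Measure

variable {V K : Type*}
  [NormedAddCommGroup V] [NormedSpace ℝ V] [FiniteDimensional ℝ V] [MeasurableSpace V] [BorelSpace V]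
  [NormedAddCommGroup K] [NormedSpace ℝ K] [FiniteDimensional ℝ K] [MeasurableSpace K] [BorelSpace K]
  {γ : Type} [Fintype γ]
variable {Q : V →ₗ[ℝ] (γ → ℝ)} {Qss : (γ → ℝ) →ₗ[ℝ] V} {ι : K →ₗ[ℝ] V}

/-- The fictitious-field coordinates as a homeomorphic linear isomorphism (finite dimension).
[cite: BalabanImbrieJaffe1988, (5.13.1) p.304] -/
def splitCLE (hQ : Q ∘ₗ Qss = LinearMap.id) (hι : Function.Injective ι)
    (hιQ : LinearMap.range ι = LinearMap.ker Q) : (K × (γ → ℝ)) ≃L[ℝ] V :=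
  (splitEquiv hQ hι hιQ).toContinuousLinearEquiv

omit [FiniteDimensional ℝ V] [MeasurableSpace V] [BorelSpace V] [MeasurableSpace K] [BorelSpace K] in
/-- `splitCLE (A₀, B) = ιA₀ + Q^{s*}B`. [cite: BalabanImbrieJaffe1988, (5.13.1) p.304] -/
theorem splitCLE_apply (hQ : Q ∘ₗ Qss = LinearMap.id) (hι : Function.Injective ι)
    (hιQ : LinearMap.range ι = LinearMap.ker Q) (p : K × (γ → ℝ)) :
    splitCLE hQ hι hιQ p = ι p.1 + Qss p.2 := rfl

/-- The Jacobian of `(A₀, B) ↦ A″`: the Haar comparison constant between `(μK ⊗ dB)∘Φ⁻¹` and `μV` (depends on the chosen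
flat normalisations only). [cite: BalabanImbrieJaffe1988, (5.13.1) p.304] -/
def jac (μV : Measure V) [μV.IsAddHaarMeasure] (μK : Measure K) [μK.IsAddHaarMeasure] (hQ : Q ∘ₗ Qss = LinearMap.id)
    (hι : Function.Injective ι) (hιQ : LinearMap.range ι = LinearMap.ker Q) : NNReal :=
  haarJac μK (volume : Measure (γ → ℝ)) μV (splitCLE hQ hι hιQ)

omit [FiniteDimensional ℝ V] in
/-- `jac > 0`. [cite: BalabanImbrieJaffe1988, (5.13.1) p.304] -/
theorem jac_pos (μV : Measure V) [μV.IsAddHaarMeasure] (μK : Measure K) [μK.IsAddHaarMeasure]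
    (hQ : Q ∘ₗ Qss = LinearMap.id) (hι : Function.Injective ι) (hιQ : LinearMap.range ι = LinearMap.ker Q) :
    0 < jac μV μK hQ hι hιQ := by
  unfold jac
  exact haarJac_pos μK (volume : Measure (γ → ℝ)) μV (splitCLE hQ hι hιQ)

/-- **`dA″ = jac · dA₀ dB`.**  For every integrand `G` on the axial configurations (vector-valued, no integrability needed):
`∫∫ G(ιA₀ + Q^{s*}B) dμK dB = jac · ∫ G dμV`. [cite: BalabanImbrieJaffe1988, (5.13.1) p.304] -/
theorem integral_split {E : Type*} [NormedAddCommGroup E] [NormedSpace ℝ E] (μV : Measure V) [μV.IsAddHaarMeasure]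
    (μK : Measure K) [μK.IsAddHaarMeasure] (hQ : Q ∘ₗ Qss = LinearMap.id) (hι : Function.Injective ι)
    (hιQ : LinearMap.range ι = LinearMap.ker Q) (G : V → E) :
    ∫ p, G (ι p.1 + Qss p.2) ∂(μK.prod (volume : Measure (γ → ℝ))) = (jac μV μK hQ hι hιQ : ℝ) • ∫ A, G A ∂μV := by
  have h := integral_comp_haarJac μK (volume : Measure (γ → ℝ)) μV (splitCLE hQ hι hιQ) G
  simpa only [splitCLE_apply, jac] using h

/-- **`𝒩`**, the normalisation after integrating out `B`: `𝒩 = ∫dB e^{−½⟨B,B⟩} / jac = √(2π)^{|γ|}/jac`.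
[cite: BalabanImbrieJaffe1988, (5.13.1) p.304] -/
def calN (μV : Measure V) [μV.IsAddHaarMeasure] (μK : Measure K) [μK.IsAddHaarMeasure] (hQ : Q ∘ₗ Qss = LinearMap.id)
    (hι : Function.Injective ι) (hιQ : LinearMap.range ι = LinearMap.ker Q) : ℝ :=
  calNB γ / (jac μV μK hQ hι hιQ : ℝ)

omit [FiniteDimensional ℝ V] in
/-- `𝒩 > 0`. [cite: BalabanImbrieJaffe1988, (5.13.1) p.304] -/
theorem calN_pos (μV : Measure V) [μV.IsAddHaarMeasure] (μK : Measure K) [μK.IsAddHaarMeasure]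
    (hQ : Q ∘ₗ Qss = LinearMap.id) (hι : Function.Injective ι) (hιQ : LinearMap.range ι = LinearMap.ker Q) :
    0 < calN μV μK hQ hι hιQ :=
  div_pos calNB_pos (by exact_mod_cast jac_pos μV μK hQ hι hιQ)

/-- **Integrating out `B`** (Fubini in the fictitious-field coordinates): for every `f`,
`∫dA″ e^{−½⟨QA″,QA″⟩} δ_Ax(A″) f((I − Q^{s*}Q)A″) = 𝒩 · ∫dA″ δ(QA″) δ_Ax(A″) f(A″)` with `𝒩 = √(2π)^{|γ|}/jac`.
[cite: BalabanImbrieJaffe1988, (5.13.1) p.304] -/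
theorem eq5131_integrated (μV : Measure V) [μV.IsAddHaarMeasure] (μK : Measure K) [μK.IsAddHaarMeasure]
    (hQ : Q ∘ₗ Qss = LinearMap.id) (hι : Function.Injective ι) (hιQ : LinearMap.range ι = LinearMap.ker Q) (f : V → ℝ) :
    ∫ A, gaussB (Q A) * f (A - Qss (Q A)) ∂μV = calN μV μK hQ hι hιQ * ∫ a, f (ι a) ∂μK := by
  have hsplit := integral_split μV μK hQ hι hιQ (fun A => gaussB (Q A) * f (A - Qss (Q A)))
  have hpt : ∀ p : K × (γ → ℝ),
      gaussB (Q (ι p.1 + Qss p.2)) * f (ι p.1 + Qss p.2 - Qss (Q (ι p.1 + Qss p.2))) = f (ι p.1) * gaussB p.2 := by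
    intro p
    have h1 : Q (ι p.1 + Qss p.2) = p.2 := Q_splitMap hQ hιQ p
    have h2 : ι p.1 + Qss p.2 - Qss (Q (ι p.1 + Qss p.2)) = ι p.1 := proj_splitMap hQ hιQ p
    rw [h2, h1, mul_comm]
  simp_rw [hpt] at hsplit
  rw [integral_prod_mul (μ := μK) (ν := (volume : Measure (γ → ℝ))) (fun a : K => f (ι a)) gaussB, smul_eq_mul]
    at hsplit
  have hj : (0 : ℝ) < (jac μV μK hQ hι hιQ : ℝ) := by exact_mod_cast jac_pos μV μK hQ hι hιQ
  have key : ∫ A, gaussB (Q A) * f (A - Qss (Q A)) ∂μV =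
      ((∫ a, f (ι a) ∂μK) * ∫ B : γ → ℝ, gaussB B) / (jac μV μK hQ hι hιQ : ℝ) := by
    rw [hsplit, mul_div_cancel_left₀ _ hj.ne']
  rw [key, calN, calNB]
  field_simp

/-- **The printed display after (5.13.1)**: *"Integrating out B yields
𝒩⁻¹∫dA^{(k)″} exp[−½⟨A^{(k)″}, Q*QA^{(k)″}⟩] δ_Ax(A^{(k)″}) f((I − Q^{s*}Q)A^{(k)″})"* — equal to the left side of (5.13.1),
`∫dA″δ(QA″)δ_Ax(A″)f(A″)`, for every `f` (`⟨A″, Q*QA″⟩ = ⟨QA″, QA″⟩`). [cite: BalabanImbrieJaffe1988, (5.13.1) p.304] -/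
theorem eq5131_out (μV : Measure V) [μV.IsAddHaarMeasure] (μK : Measure K) [μK.IsAddHaarMeasure]
    (hQ : Q ∘ₗ Qss = LinearMap.id) (hι : Function.Injective ι) (hιQ : LinearMap.range ι = LinearMap.ker Q) (f : V → ℝ) :
    deltaInt Qss ι μK 0 f = (calN μV μK hQ hι hιQ)⁻¹ * ∫ A, gaussB (Q A) * f (A - Qss (Q A)) ∂μV := by
  rw [eq5131_integrated μV μK hQ hι hιQ f, ← mul_assoc, inv_mul_cancel₀ (calN_pos μV μK hQ hι hιQ).ne', one_mul,
    deltaInt_zero]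

/-- **"the 𝒩's cancel"** (p. 304: *"Applying (5.13.1) to numerator and denominator … the 𝒩's cancel"*): normalised
expectations over the constraint surface `{QA″ = 0}` are normalised expectations in the weight `e^{−½⟨A″,Q*QA″⟩}δ_Ax` of the
observables composed with `I − Q^{s*}Q` (*"Everywhere A^{(k)″} appears as (I − Q^{s*}Q)A^{(k)″}"*), for every `f`, `g`.
[cite: BalabanImbrieJaffe1988, (5.13.1) p.304] -/
theorem ratio_eq (μV : Measure V) [μV.IsAddHaarMeasure] (μK : Measure K) [μK.IsAddHaarMeasure]
    (hQ : Q ∘ₗ Qss = LinearMap.id) (hι : Function.Injective ι) (hιQ : LinearMap.range ι = LinearMap.ker Q)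
    (f g : V → ℝ) :
    (∫ a, f (ι a) ∂μK) / (∫ a, g (ι a) ∂μK) =
      (∫ A, gaussB (Q A) * f (A - Qss (Q A)) ∂μV) / (∫ A, gaussB (Q A) * g (A - Qss (Q A)) ∂μV) := by
  rw [eq5131_integrated μV μK hQ hι hιQ f, eq5131_integrated μV μK hQ hι hιQ g,
    mul_div_mul_left _ _ (calN_pos μV μK hQ hι hιQ).ne']


/-- The Gaussian unit weight is integrable `dB`. [cite: BalabanImbrieJaffe1988, (5.13.1) p.304] -/
theorem integrable_gaussB : Integrable (gaussB : (γ → ℝ) → ℝ) (volume : Measure (γ → ℝ)) :=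
  Beta.GaussianIntegral.integrable_exp_neg_half_dotProduct_self

/-- Integrability bookkeeping for consumers: the weighted integrand on the axial configurations is integrable iff `f∘ι` is
integrable on the constraint surface — so the two sides of `eq5131_integrated` are finite exactly together (and equal junk
`0` otherwise). [cite: BalabanImbrieJaffe1988, (5.13.1) p.304] -/
theorem integrable_iff (μV : Measure V) [μV.IsAddHaarMeasure] (μK : Measure K) [μK.IsAddHaarMeasure]
    (hQ : Q ∘ₗ Qss = LinearMap.id) (hι : Function.Injective ι) (hιQ : LinearMap.range ι = LinearMap.ker Q) (f : V → ℝ) :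
    Integrable (fun A => gaussB (Q A) * f (A - Qss (Q A))) μV ↔ Integrable (fun a => f (ι a)) μK := by
  set e := splitCLE hQ hι hιQ with he
  set G : V → ℝ := fun A => gaussB (Q A) * f (A - Qss (Q A)) with hG
  have hmap : (μK.prod (volume : Measure (γ → ℝ))).map e = jac μV μK hQ hι hιQ • μV := by
    unfold jac haarJac
    exact B5ChangeOfGauge123.map_slice_orbit_eq_smul μK (volume : Measure (γ → ℝ)) μV e
  have hj : jac μV μK hQ hι hιQ ≠ 0 := (jac_pos μV μK hQ hι hιQ).ne'
  -- (i) integrability for `μV` ⇔ for `(μK ⊗ dB)∘e⁻¹ = jac • μV`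
  have h1 : Integrable G μV ↔ Integrable G ((μK.prod (volume : Measure (γ → ℝ))).map e) := by
    rw [hmap]
    refine ⟨fun h => h.smul_measure_nnreal, fun h => ?_⟩
    have h' := h.smul_measure_nnreal (c := (jac μV μK hQ hι hιQ)⁻¹)
    rwa [smul_smul, inv_mul_cancel₀ hj, one_smul] at h'
  -- (ii) pull back along the measurable equivalence `e`
  have h2 : Integrable G ((μK.prod (volume : Measure (γ → ℝ))).map e) ↔
      Integrable (G ∘ e) (μK.prod (volume : Measure (γ → ℝ))) :=
    integrable_map_equiv e.toHomeomorph.toMeasurableEquiv G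
  -- (iii) in the fictitious-field coordinates the integrand factorises
  have h3 : G ∘ e = fun p : K × (γ → ℝ) => f (ι p.1) * gaussB p.2 := by
    funext p
    have h1' : Q (ι p.1 + Qss p.2) = p.2 := Q_splitMap hQ hιQ p
    simp only [hG, Function.comp_apply, he, splitCLE_apply, h1', add_sub_cancel_right, mul_comm]
  -- (iv) a product with the (integrable, nowhere zero) Gaussian factor
  have h4 : Integrable (fun p : K × (γ → ℝ) => f (ι p.1) * gaussB p.2) (μK.prod (volume : Measure (γ → ℝ))) ↔
      Integrable (fun a => f (ι a)) μK := by
    constructor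
    · intro h
      obtain ⟨B, hB⟩ := (h.prod_left_ae).exists
      exact (integrable_mul_const_iff (isUnit_iff_ne_zero.2 (gaussB_pos B).ne') _).1 hB
    · intro h
      exact h.mul_prod integrable_gaussB
  rw [h1, h2, h3, h4]

end Measure

/-! ## §4  Non-vacuity: the product model `V = K × (γ → ℝ)`, `Q = snd`, `Q^{s*} = inr`, `ι = inl` -/

section ProductModel

/-- The three hypotheses `QQ^{s*} = I`, `ι` injective, `ι(K) = ker Q` hold in the product model (so the identities above are
not vacuous). [cite: BalabanImbrieJaffe1988, (5.13.1) p.304] -/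
theorem productModel_hyps (K : Type*) [AddCommGroup K] [Module ℝ K] (γ : Type) :
    (LinearMap.snd ℝ K (γ → ℝ)) ∘ₗ (LinearMap.inr ℝ K (γ → ℝ)) = LinearMap.id ∧
      Function.Injective (LinearMap.inl ℝ K (γ → ℝ)) ∧
      LinearMap.range (LinearMap.inl ℝ K (γ → ℝ)) = LinearMap.ker (LinearMap.snd ℝ K (γ → ℝ)) :=
  ⟨LinearMap.snd_comp_inr ℝ K (γ → ℝ), LinearMap.inl_injective, LinearMap.range_inl ℝ K (γ → ℝ)⟩

variable (K : Type*) [NormedAddCommGroup K] [NormedSpace ℝ K] [FiniteDimensional ℝ K] [MeasurableSpace K] [BorelSpace K]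
  (γ : Type) [Fintype γ]

/-- "Integrating out B" in the product model: for every Haar measures `μV` on `K × (γ → ℝ)` and `μK` on `K` and every `f`,
`∫ f(a, 0) dμK(a) = 𝒩⁻¹ ∫ e^{−½⟨B,B⟩} f(a, 0) dμV(a, B)`. [cite: BalabanImbrieJaffe1988, (5.13.1) p.304] -/
theorem eq5131_out_productModel (μV : Measure (K × (γ → ℝ))) [μV.IsAddHaarMeasure] (μK : Measure K)
    [μK.IsAddHaarMeasure] (f : K × (γ → ℝ) → ℝ) :
    ∫ a, f (a, 0) ∂μK =
      (calN μV μK (productModel_hyps K γ).1 (productModel_hyps K γ).2.1 (productModel_hyps K γ).2.2)⁻¹ *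
        ∫ A, gaussB A.2 * f (A.1, 0) ∂μV := by
  have h := eq5131_out μV μK (productModel_hyps K γ).1 (productModel_hyps K γ).2.1 (productModel_hyps K γ).2.2 f
  rw [deltaInt_zero] at h
  have hpt : ∀ A : K × (γ → ℝ), A - ((0 : K), A.2) = (A.1, 0) := fun A => by ext <;> simp
  simpa [hpt] using h

end ProductModel

end Literature.MathematicalPhysics.QuantumFieldTheory.BalabanImbrieJaffe1984to88.BIJ88FictitiousField5131

end
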